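import Literature.MathematicalPhysics.QuantumFieldTheory.Balaban1983to89.B1Eq17Urep
import Literature.MathematicalPhysics.QuantumFieldTheory.Balaban1983to89.B3Sect2StatementsPart2

/-!
# `Balaban1983to89.B3WT223Instance` — T. Bałaban, *(Higgs)₂,₃ quantum fields in a finite volume. III. Renormalization*,
# Commun. Math. Phys. **88** (1983) 411–445 [Balaban1983Higgs3], (2.23) p. 430: the basic Ward–Takahashi identity ON THE
# CONCRETE LATTICE MODEL — gauge rotation of the scalar fields, its action on `⟨φ,(−Δ^η_A+M²)φ⟩`, measure preservation, (2.23)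

statement-level skeleton of published theorems with citation tags; proofs where landed; nothing here is a claim about the Yang–Mills mass gap

PDF held: `paper:balaban1983-higgs-2-3-quantum-fields-finite-volume` (journal page = PDF page + 410); p. 430 read on the ×2 render
`run/shared/lean/pub/pub-balaban/b2b-balaban-ref1/pages/1983-cmp88-higgs23-III/1983-cmp88-higgs23-III-p020-x2.png` (as an image),
B1 = [Balaban1982Higgs1] p. 605 ((1.7), `U(A) = exp(qεeA)`) on `…/1982-cmp85-higgs23-I/…-p003-x2.png`.

WHAT IS REPRODUCED.  SKELETON row **B3.Eq2.23** of `run/shared/lean/pub/lit-balaban/SKELETON.md` (p. 430 [PDF 20], verbatim: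
*"These identities express a gauge invariance of the scalar field part of the theory. The basic identity has the form:
∫dφ exp[−½⟨φ,(−Δ^η_{A−e_k∂^ηλ} + M²)φ⟩]F(φ) = ∫dφ exp[−½⟨φ,(−Δ^η_A + M²)φ⟩]F(φ), (2.23) where e_k = e(L^kε), M² > 0, F(φ) is an
arbitrary gauge-invariant function of scalar fields."*), whose decl of record `B3Sect2StatementsPart2.integral_eq_of_gaugeInvariant`
(r15, p239134) proves the ABSTRACT mechanism (a measure-preserving bijection `g`, a weight `w`, `wg = w ∘ g`, `F ∘ g = F`) and leaves,
in its own words, *"the lattice facts in parentheses [to] what an instantiation supplies"*.  THIS FILE supplies them for the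
`(Higgs)₂,₃` lattice model on the carriers of `…Balaban1983to89.LatticeFieldCalculus` (shared with p20's `B3Eq28SummationByParts`):
scalar fields `φ : T^{(j)} → R^N` (`Cfg P j N = SiteField P j (EuclideanSpace ℝ (Fin N))`) with the Lebesgue measure `dφ` (`volume`
of the product of Euclidean spaces), the covariant derivative `covDerivScalar c (C.Urep η) A φ` of B1 (1.7) with the CONCRETE
representation `U(A) = exp(qηeA)` (`HiggsLattice.ChargeData.U`, as `Urep` by p32's `B1Eq17Urep`, reserve R7), the covariant Laplace
form `covLaplaceForm` (B1 p. 605 *"−Δ_A = D*_A D_A"*), and: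
* `rot C η c λ` — the gauge transformation of the scalar fields, `φ^λ(x) = U(η·(−cλ(x)))φ(x)` (rotation by the angle `−ηecλ(x)`;
  the print's normalisation `e_k∂^ηλ` of the gauge function is absorbed in `λ`, which is arbitrary), a one-parameter family of
  sitewise unitaries (`rot_add`, `rot_zero`), hence a measurable equivalence `rotEquiv` PRESERVING `dφ` (`measurePreserving_rot`,
  from Mathlib's `volume_preserving_pi` and `LinearIsometryEquiv.measurePreserving`);
* `covDerivScalar_rot` — **`(D^η_A φ^λ)(b) = U(−λ(b₋))·(D^η_{A−∂^ηλ}φ)(b)`**, so `⟨φ^λ,(−Δ^η_A)φ^λ⟩ = ⟨φ,(−Δ^η_{A−∂^ηλ})φ⟩`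
  (`covLaplaceForm_rot`; `A − ∂^ηλ = LatticeFieldCalculus.gaugeShift c λ A`), the lattice identification the r15 file cites as
  *"B1 (1.7)-calculus, not re-proved here"*;
* `quadForm`/`weight` = `⟨φ,(−Δ^η_A+M²)φ⟩` and `exp[−½⟨φ,(−Δ^η_A+M²)φ⟩]` (weight `w = η^d`, lattice factor `c = η⁻¹`, `M²`
  bookkeeping reals as in `LatticeFieldCalculus`), their transformation law and the Gaussian majorant `weight_le_gauss`;
* `eq223` — **(2.23) for the model**: `∫dφ e^{−½⟨φ,(−Δ_{A−∂λ}+M²)φ⟩}F(φ) = ∫dφ e^{−½⟨φ,(−Δ_A+M²)φ⟩}F(φ)` for every `F` with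
  `F(φ^λ) = F(φ)`, obtained from `integral_eq_of_gaugeInvariant` BY NAME.
The sequel `…B3WT224Instance` differentiates this in `λ` ((2.24)) and specializes ((2.25)).  Phase-2 RESERVE R11 (part 1) of
`PHASE2-TARGETS.md` §G.3; cell `lit-balaban`, seat p39 (gen 2, unit `lit-balaban-p39`), HOME `run/shared/lean/pub/lit-balaban/`.
Nothing beyond these lattice identities is asserted; no new `Prop` is introduced.
-/

noncomputable section

open scoped BigOperators InnerProductSpace

namespace Literature.MathematicalPhysics.QuantumFieldTheory.Balaban1983to89.B3WT223Instance

open _root_.MeasureTheory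
open LatticeFieldCalculus

variable {P : Params} {j N : ℕ} (C : HiggsLattice.ChargeData N) (η : ℝ)

/-- Scalar field configurations `φ : T^{(j)} → R^N` (*"functions of scalar fields"*, p. 430), on the `Setup` torus of level `j`.
[cite: Balaban1983Higgs3, (2.23) p.430] -/
abbrev Cfg (P : Params) (j N : ℕ) : Type := SiteField P j (EuclideanSpace ℝ (Fin N))

/-! ## §1 The gauge transformation of the scalar fields -/

/-- The gauge transformation of the scalar fields by a gauge function `λ : T^{(j)} → R`: at the site `x` the field is rotated by
`U(η·(−cλ(x))) = exp(−qηecλ(x))` (`U` of B1 (1.7); `c = η⁻¹`), chosen so that `D_A(φ^λ) = U(−cλ(b₋))·D_{A−∂λ}φ` bondwise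
(`covDerivScalar_rot`) — the transformation whose invariance (2.23) expresses. [cite: Balaban1983Higgs3, (2.23) p.430] -/
def rot (c : ℝ) (lam : Site P j → ℝ) (φ : Cfg P j N) : Cfg P j N :=
  fun x => C.U η (-(c * lam x)) (φ x)

/-- pointwise form of `rot`. [cite: Balaban1983Higgs3, (2.23) p.430] -/
theorem rot_apply (c : ℝ) (lam : Site P j → ℝ) (φ : Cfg P j N) (x : Site P j) :
    rot C η c lam φ x = C.U η (-(c * lam x)) (φ x) := rfl

/-- `U(a)U(b)v = U(a+b)v` (B1 p. 605: `U` is a representation of `(R,+)`). [cite: Balaban1982Higgs1, (1.7) p.605] -/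
theorem U_U (a b : ℝ) (v : EuclideanSpace ℝ (Fin N)) : C.U η a (C.U η b v) = C.U η (a + b) v := by
  rw [HiggsLattice.ChargeData.U_add]
  rfl

/-- the trivial gauge function acts trivially. [cite: Balaban1983Higgs3, (2.23) p.430] -/
theorem rot_zero (c : ℝ) (φ : Cfg P j N) : rot C η c (0 : Site P j → ℝ) φ = φ := by
  funext x
  simp [rot_apply, HiggsLattice.ChargeData.U_zero]

/-- gauge transformations compose additively in `λ`. [cite: Balaban1983Higgs3, (2.23) p.430] -/
theorem rot_add (c : ℝ) (lam lam' : Site P j → ℝ) (φ : Cfg P j N) :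
    rot C η c (lam + lam') φ = rot C η c lam (rot C η c lam' φ) := by
  funext x
  rw [rot_apply, rot_apply, rot_apply, U_U]
  congr 1
  simp only [Pi.add_apply]
  ring

/-- `−λ` undoes `λ`. [cite: Balaban1983Higgs3, (2.23) p.430] -/
theorem rot_neg_rot (c : ℝ) (lam : Site P j → ℝ) (φ : Cfg P j N) : rot C η c (-lam) (rot C η c lam φ) = φ := by
  rw [← rot_add, neg_add_cancel, rot_zero]

/-- `λ` undoes `−λ`. [cite: Balaban1983Higgs3, (2.23) p.430] -/
theorem rot_rot_neg (c : ℝ) (lam : Site P j → ℝ) (φ : Cfg P j N) : rot C η c lam (rot C η c (-lam) φ) = φ := by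
  rw [← rot_add, add_neg_cancel, rot_zero]

/-- `U(θ)` as a linear isometric equivalence of `R^N` (B1 p. 605: *"in unitary operators on R^N"*).
[cite: Balaban1982Higgs1, (1.7) p.605] -/
def Uiso (θ : ℝ) : EuclideanSpace ℝ (Fin N) ≃ₗᵢ[ℝ] EuclideanSpace ℝ (Fin N) :=
  Unitary.linearIsometryEquiv ⟨C.U η θ, C.U_mem_unitary η θ⟩

/-- `Uiso` acts as `U(θ)`. [cite: Balaban1982Higgs1, (1.7) p.605] -/
theorem Uiso_apply (θ : ℝ) (v : EuclideanSpace ℝ (Fin N)) : Uiso C η θ v = C.U η θ v := rfl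

/-- the gauge transformation is continuous on field space. [cite: Balaban1983Higgs3, (2.23) p.430] -/
theorem continuous_rot (c : ℝ) (lam : Site P j → ℝ) : Continuous (rot C η c lam : Cfg P j N → Cfg P j N) :=
  continuous_pi fun x => (C.U η (-(c * lam x))).continuous.comp (continuous_apply x)

/-- the gauge transformation as a measurable equivalence of field space (inverse: the transformation by `−λ`).
[cite: Balaban1983Higgs3, (2.23) p.430] -/
def rotEquiv (c : ℝ) (lam : Site P j → ℝ) : Cfg P j N ≃ᵐ Cfg P j N where
  toFun := rot C η c lam
  invFun := rot C η c (-lam)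
  left_inv := rot_neg_rot C η c lam
  right_inv := rot_rot_neg C η c lam
  measurable_toFun := (continuous_rot C η c lam).measurable
  measurable_invFun := (continuous_rot C η c (-lam)).measurable

/-- **The gauge transformation preserves the Lebesgue measure `dφ`** (it is a product over the sites of rotations of `R^N`) — the
hypothesis `hg` of `integral_eq_of_gaugeInvariant`, for the lattice model. [cite: Balaban1983Higgs3, (2.23) p.430] -/
theorem measurePreserving_rot (c : ℝ) (lam : Site P j → ℝ) :
    MeasurePreserving (rot C η c lam : Cfg P j N → Cfg P j N) volume volume :=
  volume_preserving_pi (α' := fun _ : Site P j => EuclideanSpace ℝ (Fin N)) (β' := fun _ : Site P j => EuclideanSpace ℝ (Fin N))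
    (f := fun x v => Uiso C η (-(c * lam x)) v) fun x => (Uiso C η (-(c * lam x))).measurePreserving

/-- **`(D^η_A φ^λ)(b) = U(−cλ(b₋))·(D^η_{A−∂^ηλ}φ)(b)`** — the covariant derivative (B1 (1.7), `(D_Aφ)(b) = c·(U(A_b)φ(b₊) − φ(b₋))`)
of the gauge-transformed field is the transported covariant derivative along the gauge-shifted background `A − ∂^ηλ`
(`LatticeFieldCalculus.gaugeShift`); uses only that `U` is a representation of `(R,+)` by commuting operators.
[cite: Balaban1983Higgs3, (2.23) p.430] -/
theorem covDerivScalar_rot (c : ℝ) (lam : Site P j → ℝ) (A : VecField P j ℝ) (φ : Cfg P j N) (b : PBond P j) :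
    covDerivScalar c (C.Urep η) A (rot C η c lam φ) b =
      C.U η (-(c * lam b.src)) (covDerivScalar c (C.Urep η) (gaugeShift c lam A) φ b) := by
  simp only [covDerivScalar, rot_apply, HiggsLattice.ChargeData.Urep_apply, gaugeShift, grad, smul_eq_mul, map_smul, map_sub,
    U_U]
  congr 3
  ring

/-- … hence `|(D^η_A φ^λ)(b)| = |(D^η_{A−∂^ηλ}φ)(b)|` (`U` unitary). [cite: Balaban1983Higgs3, (2.23) p.430] -/
theorem norm_covDerivScalar_rot (c : ℝ) (lam : Site P j → ℝ) (A : VecField P j ℝ) (φ : Cfg P j N) (b : PBond P j) :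
    ‖covDerivScalar c (C.Urep η) A (rot C η c lam φ) b‖ = ‖covDerivScalar c (C.Urep η) (gaugeShift c lam A) φ b‖ := by
  rw [covDerivScalar_rot]
  exact ContinuousLinearMap.norm_map_of_mem_unitary (C.U_mem_unitary η _) _

/-- **`⟨φ^λ, (−Δ^η_A)φ^λ⟩ = ⟨φ, (−Δ^η_{A−∂^ηλ})φ⟩`**: the covariant Laplace form transforms by the gauge shift of the background —
the lattice identification used in (2.23) (in print with the gauge function normalised as `e_k∂^ηλ`).
[cite: Balaban1983Higgs3, (2.23) p.430] -/
theorem covLaplaceForm_rot (w c : ℝ) (lam : Site P j → ℝ) (A : VecField P j ℝ) (φ : Cfg P j N) :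
    covLaplaceForm w c (C.Urep η) A (rot C η c lam φ) = covLaplaceForm w c (C.Urep η) (gaugeShift c lam A) φ := by
  unfold covLaplaceForm
  simp_rw [norm_covDerivScalar_rot]

/-- the mass term `M²Σ_x η^d|φ(x)|²` is invariant under the gauge transformation (sitewise unitaries).
[cite: Balaban1983Higgs3, (2.23) p.430] -/
theorem massTerm_rot (w c : ℝ) (lam : Site P j → ℝ) (φ : Cfg P j N) :
    ∑ x : Site P j, w * ‖rot C η c lam φ x‖ ^ 2 = ∑ x : Site P j, w * ‖φ x‖ ^ 2 := by
  refine Finset.sum_congr rfl fun x _ => ?_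
  rw [rot_apply, ContinuousLinearMap.norm_map_of_mem_unitary (C.U_mem_unitary η _)]

/-! ## §2 The quadratic form `⟨φ, (−Δ^η_A + M²)φ⟩` and the Gaussian weight of (2.23) -/

section Forms

variable (w c M2 : ℝ)

/-- the mass term `Σ_x η^d |φ(x)|²` (weight `w = η^d`). [cite: Balaban1983Higgs3, (2.23) p.430] -/
def massForm (w : ℝ) (φ : Cfg P j N) : ℝ := ∑ x : Site P j, w * ‖φ x‖ ^ 2

/-- `⟨φ, (−Δ^η_A + M²)φ⟩ = Σ_b η^d |(D^η_Aφ)(b)|² + M² Σ_x η^d |φ(x)|²`, the quadratic form in the exponent of (2.23) (B1 p. 605: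
`−Δ_A = D*_A D_A`). [cite: Balaban1983Higgs3, (2.23) p.430] -/
def quadForm (A : VecField P j ℝ) (φ : Cfg P j N) : ℝ :=
  covLaplaceForm w c (C.Urep η) A φ + M2 * massForm w φ

/-- `exp[−½⟨φ, (−Δ^η_A + M²)φ⟩]`, the Gaussian weight of (2.23). [cite: Balaban1983Higgs3, (2.23) p.430] -/
def weight (A : VecField P j ℝ) (φ : Cfg P j N) : ℝ :=
  Real.exp (-(1 / 2 : ℝ) * quadForm C η w c M2 A φ)

variable {C η w c M2}

/-- `Σ_x η^d|φ(x)|² = η^d Σ_x |φ(x)|²`. [cite: Balaban1983Higgs3, (2.23) p.430] -/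
theorem massForm_eq (φ : Cfg P j N) : massForm w φ = w * ∑ x : Site P j, ‖φ x‖ ^ 2 := by
  rw [massForm, Finset.mul_sum]

/-- the mass term is gauge invariant. [cite: Balaban1983Higgs3, (2.23) p.430] -/
theorem massForm_rot (lam : Site P j → ℝ) (φ : Cfg P j N) : massForm w (rot C η c lam φ) = massForm w φ :=
  massTerm_rot C η w c lam φ

/-- `⟨φ^λ, (−Δ^η_A + M²)φ^λ⟩ = ⟨φ, (−Δ^η_{A−∂^ηλ} + M²)φ⟩`. [cite: Balaban1983Higgs3, (2.23) p.430] -/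
theorem quadForm_rot (lam : Site P j → ℝ) (A : VecField P j ℝ) (φ : Cfg P j N) :
    quadForm C η w c M2 A (rot C η c lam φ) = quadForm C η w c M2 (gaugeShift c lam A) φ := by
  unfold quadForm
  rw [covLaplaceForm_rot, massForm_rot]

/-- `exp[−½⟨φ^λ,(−Δ^η_A+M²)φ^λ⟩] = exp[−½⟨φ,(−Δ^η_{A−∂^ηλ}+M²)φ⟩]` — the hypothesis `hw : wg = w ∘ g` of `integral_eq_of_gaugeInvariant`
for the lattice model. [cite: Balaban1983Higgs3, (2.23) p.430] -/
theorem weight_rot (lam : Site P j → ℝ) (A : VecField P j ℝ) (φ : Cfg P j N) :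
    weight C η w c M2 A (rot C η c lam φ) = weight C η w c M2 (gaugeShift c lam A) φ := by
  unfold weight
  rw [quadForm_rot]

/-- `⟨φ,(−Δ^η_A)φ⟩ ≥ 0` for `η^d ≥ 0`. [cite: Balaban1983Higgs3, (2.23) p.430] -/
theorem covLaplaceForm_nonneg (hw : 0 ≤ w) (A : VecField P j ℝ) (φ : Cfg P j N) : 0 ≤ covLaplaceForm w c (C.Urep η) A φ :=
  Finset.sum_nonneg fun _ _ => mul_nonneg hw (sq_nonneg _)

/-- the mass term is non-negative for `η^d ≥ 0`. [cite: Balaban1983Higgs3, (2.23) p.430] -/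
theorem massForm_nonneg (hw : 0 ≤ w) (φ : Cfg P j N) : 0 ≤ massForm w φ :=
  Finset.sum_nonneg fun _ _ => mul_nonneg hw (sq_nonneg _)

/-- the Gaussian weight is positive. [cite: Balaban1983Higgs3, (2.23) p.430] -/
theorem weight_pos (A : VecField P j ℝ) (φ : Cfg P j N) : 0 < weight C η w c M2 A φ := Real.exp_pos _

/-- **Gaussian majorant**: `exp[−½⟨φ,(−Δ^η_A+M²)φ⟩] ≤ exp[−(M²η^d/2) Σ_x|φ(x)|²]`, uniformly in the background `A`
(the covariant Laplace form is non-negative). [cite: Balaban1983Higgs3, (2.23) p.430] -/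
theorem weight_le_gauss (hw : 0 ≤ w) (A : VecField P j ℝ) (φ : Cfg P j N) :
    weight C η w c M2 A φ ≤ Real.exp (-(M2 * w / 2) * ∑ x : Site P j, ‖φ x‖ ^ 2) := by
  unfold weight quadForm
  rw [Real.exp_le_exp, massForm_eq]
  have h := covLaplaceForm_nonneg (C := C) (η := η) (c := c) hw A φ
  have hs : 0 ≤ ∑ x : Site P j, ‖φ x‖ ^ 2 := Finset.sum_nonneg fun _ _ => sq_nonneg _
  nlinarith

end Forms

/-! ## §3 (2.23) for the lattice model -/

section Eq223

variable (w c M2 : ℝ)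

/-- **(2.23) p. 430 [PDF 20] for the concrete `(Higgs)₂,₃` lattice model**, verbatim: *"The basic identity has the form:
∫dφ exp[−½⟨φ,(−Δ^η_{A−e_k∂^ηλ} + M²)φ⟩]F(φ) = ∫dφ exp[−½⟨φ,(−Δ^η_A + M²)φ⟩]F(φ), (2.23) where e_k = e(L^kε), M² > 0, F(φ) is an
arbitrary gauge-invariant function of scalar fields."* — for the Lebesgue measure `dφ` on `φ : T^{(j)} → R^N`, the covariant Laplace
form of B1 (1.7) with `U(A) = exp(qηeA)`, the gauge shift `A ↦ A − ∂^ηλ` of the background (the print's normalisation `e_k∂^ηλ` of the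
arbitrary gauge function absorbed in `λ`) paired with the rotation `φ^λ = rot C η c λ φ` of the scalar fields, and ANY `F` with
`F(φ^λ) = F(φ)` (no integrability needed: both sides are the same Bochner integral after the measure-preserving change of variables).
Proof = the decl of record `B3Sect2StatementsPart2.integral_eq_of_gaugeInvariant` BY NAME, fed with `measurePreserving_rot` and
`weight_rot`. [cite: Balaban1983Higgs3, (2.23) p.430] -/
theorem eq223 (lam : Site P j → ℝ) (A : VecField P j ℝ) (F : Cfg P j N → ℝ) (hF : ∀ φ, F (rot C η c lam φ) = F φ) :
    ∫ φ, weight C η w c M2 (gaugeShift c lam A) φ * F φ = ∫ φ, weight C η w c M2 A φ * F φ :=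
  B3Sect2StatementsPart2.integral_eq_of_gaugeInvariant volume (rotEquiv C η c lam) (measurePreserving_rot C η c lam)
    (fun φ => weight C η w c M2 A φ) (fun φ => weight C η w c M2 (gaugeShift c lam A) φ) F
    (fun φ => (weight_rot lam A φ).symm) hF

end Eq223

end Literature.MathematicalPhysics.QuantumFieldTheory.Balaban1983to89.B3WT223Instance

end
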